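import Literature.AlgebraicGeometry.Motives.MixedHodgeExtensionUnitInternalHomNonSeparated
import Literature.AlgebraicGeometry.Motives.MixedHodgeExtensionByTate
import Literature.AlgebraicGeometry.Motives.MixedHodgeStructureInternalHomCurry
import HarnessLib

/-!
# The tensor–Hom adjunction on `Ext¹`: `Ext(A ⊗ C, B) ≅ Ext(A, Hom(C, B)) ≅ Ext(A, C^∨ ⊗ B)`

Deligne–Milne, *Tannakian categories* (LNM 900), §1 (1.6.1)–(1.6.4): the internal Hom of a tensor
category is characterised by `Hom(T ⊗ X, Y) = Hom(T, Hom(X, Y))` functorially in `T`, and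
`Hom(X, Y) ≅ X^∨ ⊗ Y` in the rigid case; Jannsen, *Mixed Motives and Algebraic K-Theory* (LNM 1400),
§9 Remark 9.3 a) is the `Ext¹`-version for `T = ℤ`: `α : Ext¹(ℤ, Hom(A, B)) ≅ Ext¹(A, B)` (over `ℚ`).
The tree has the curry isomorphism of mixed Hodge structures
`homTensorCurry A C B : Hom(A ⊗ C, B) ≅ Hom(A, Hom(C, B))` (`MixedHodgeStructureInternalHomCurry`),
the isomorphism `Hom(C, B) ≅ C^∨ ⊗ B` (`homToTensor`), and Jannsen's
`Ext.unitInternalHomEquivW A B : Ext(ℚ(0), Hom(A, B)) ≃ Ext(A, B)` for ALL finite-dimensional `A`, `B`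
(`MixedHodgeExtensionUnitInternalHomNonSeparated`). Composing them gives the **tensor–Hom adjunction
for extension groups**, for arbitrary finite-dimensional mixed `ℚ`-Hodge structures:

* §1 **`Ext.tensorHomAdj A C B : Ext(A ⊗ C, B) ≃ Ext(A, Hom(C, B))`**
  `= unitInternalHomEquivW ∘ (curry)_* ∘ unitInternalHomEquivW⁻¹`; additive (Baer sums), split class
  to split class.
* §2 **its characterisation on Beilinson's groups**: under the second form of Brylinski–Zucker's
  Prop. 5.22, `Ext(X, Y) ≅ J⁰_W(Hom(X, Y))`, the adjunction is the map induced by the curry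
  isomorphism, `extEquivJacobianWHom (adj x) = J⁰_W(curry) (extEquivJacobianWHom x)`
  (`Ext.extEquivJacobianWHom_tensorHomAdj`), and it is the unique such map.
* §3 the rigid form **`Ext.tensorDualAdj A C B : Ext(A ⊗ C, B) ≃ Ext(A, C^∨ ⊗ B)`** (push-out along
  `Hom(C, B) ≅ C^∨ ⊗ B`), additive.

All statements proved; no named facts.

## References

* [DeligneMilne1982Tannakian] P. Deligne, J. S. Milne, Tannakian categories, LNM 900 (1982), §1
  (1.6.1)–(1.6.4).
* [Jannsen1990MixedMotives] U. Jannsen, Mixed Motives and Algebraic K-Theory, LNM 1400 (1990), §9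
  Lemma 9.2, Remark 9.3 a) (store `book:jannsennd-mixed-motives-algebraic-k-theory`, chunks
  p0099–p0100).
* [BrylinskiZucker1998] J.-L. Brylinski, S. Zucker, An overview of recent advances in Hodge theory,
  Prop. 5.22 (second form).
* [MacLane1963Homology] S. Mac Lane, Homology (1963), Ch. III §1 (1.4'), Thm. 2.1.
-/

open scoped TensorProduct

noncomputable section

namespace Literature.AlgebraicGeometry.Motives

namespace MixedHodgeStructure

open HodgeStructure (tate)

universe u v x w w'

variable {VA : Type u} [AddCommGroup VA] [Module ℚ VA] [FiniteDimensional ℚ VA]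
variable {VB : Type v} [AddCommGroup VB] [Module ℚ VB] [FiniteDimensional ℚ VB]
variable {VC : Type x} [AddCommGroup VC] [Module ℚ VC] [FiniteDimensional ℚ VC]
variable {VE : Type w} [AddCommGroup VE] [Module ℚ VE] [FiniteDimensional ℚ VE]
variable {VE' : Type w'} [AddCommGroup VE'] [Module ℚ VE'] [FiniteDimensional ℚ VE']

namespace Ext

/-! ### §0 A group-theoretic helper on `Ext` -/

omit [FiniteDimensional ℚ VA] [FiniteDimensional ℚ VB] in
/-- In `Ext(A, B)`: `a + b = 0` forces `a = -b` (through `Ext ≅ J⁰W₀Hom`). [cite: MacLane1963Homology, Ch. III Thm. 2.1] -/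
theorem eq_negW_of_addW_eq_zeroW {A : MixedHodgeStructure VA} {B : MixedHodgeStructure VB}
    {a b : Ext A B} (h : addW a b = zeroW) : a = negW b :=
  extEquivJHomW.injective (by
    have h' := congrArg extEquivJHomW h
    rw [extEquivJHomW_addW, extEquivJHomW_zeroW] at h'
    rw [extEquivJHomW_negW]
    exact eq_neg_of_add_eq_zero_left h')

omit [FiniteDimensional ℚ VA] [FiniteDimensional ℚ VB] [FiniteDimensional ℚ VC] in
/-- An additive map `Ext(A, B) → Ext(A', B')` preserving the split class preserves opposites.
[cite: MacLane1963Homology, Ch. III Thm. 2.1] -/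
theorem map_negW_of_addW {VA' : Type*} [AddCommGroup VA'] [Module ℚ VA'] {A : MixedHodgeStructure VA}
    {B : MixedHodgeStructure VB} {A' : MixedHodgeStructure VA'} {B' : MixedHodgeStructure VC}
    (f : Ext A B → Ext A' B') (hadd : ∀ x y, f (addW x y) = addW (f x) (f y)) (h0 : f zeroW = zeroW)
    (x : Ext A B) : f (negW x) = negW (f x) :=
  eq_negW_of_addW_eq_zeroW (by rw [← hadd, negW_addW_cancel, h0])

/-! ### §1 `Ext(A ⊗ C, B) ≃ Ext(A, Hom(C, B))` -/

variable (A : MixedHodgeStructure VA) (C : MixedHodgeStructure VC) (B : MixedHodgeStructure VB)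

/-- **The tensor–Hom adjunction for extension groups of mixed Hodge structures**:
`Ext(A ⊗ C, B) ≃ Ext(A, Hom(C, B))` for all finite-dimensional mixed `ℚ`-Hodge structures, the
composite `Ext(A ⊗ C, B) ≅ Ext(ℚ(0), Hom(A ⊗ C, B)) ≅ Ext(ℚ(0), Hom(A, Hom(C, B))) ≅ Ext(A, Hom(C, B))`
of Jannsen's `α⁻¹` (Remark 9.3 a)), the push-out along the curry isomorphism of MHS
`Hom(A ⊗ C, B) ≅ Hom(A, Hom(C, B))` (Deligne–Milne (1.6.1)–(1.6.3)), and Jannsen's `α`.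
[cite: DeligneMilne1982Tannakian, §1 (1.6.1)] [cite: Jannsen1990MixedMotives, §9 Remark 9.3 a)] -/
def tensorHomAdj : Ext (tensor A C) B ≃ Ext A (hom C B) :=
  (unitInternalHomEquivW (tensor A C) B).symm.trans
    ((pushoutEquivW (A := (tate (-0)).toMixedHodgeStructure) (homTensorCurry A C B)
      (homTensorCurry_bijective A C B)).trans (unitInternalHomEquivW A (hom C B)))

/-- Unfolding the adjunction: `adj x = α (curry_* (α⁻¹ x))`. [cite: DeligneMilne1982Tannakian, §1 (1.6.1)] -/
theorem tensorHomAdj_apply (x : Ext (tensor A C) B) :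
    tensorHomAdj A C B x =
      unitInternalHomEquivW A (hom C B)
        (pushoutMapW (homTensorCurry A C B) ((unitInternalHomEquivW (tensor A C) B).symm x)) := by
  rw [tensorHomAdj, Equiv.trans_apply, Equiv.trans_apply, pushoutEquivW_apply]

/-- The inverse adjunction: `adj⁻¹ y = α (uncurry_* (α⁻¹ y))`. [cite: DeligneMilne1982Tannakian, §1 (1.6.1)] -/
theorem tensorHomAdj_symm_apply (y : Ext A (hom C B)) :
    (tensorHomAdj A C B).symm y =
      unitInternalHomEquivW (tensor A C) B
        (pushoutMapW (homTensorUncurry A C B) ((unitInternalHomEquivW A (hom C B)).symm y)) := by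
  rw [tensorHomAdj, Equiv.symm_trans_apply, Equiv.symm_trans_apply, Equiv.symm_symm, pushoutEquivW_symm_apply,
    homTensorUncurry]

/-- **The adjunction is additive** (Baer sum to Baer sum). [cite: Jannsen1990MixedMotives, §9 Remark 9.3 a)] -/
theorem tensorHomAdj_addW (x y : Ext (tensor A C) B) :
    tensorHomAdj A C B (addW x y) = addW (tensorHomAdj A C B x) (tensorHomAdj A C B y) := by
  rw [tensorHomAdj_apply, tensorHomAdj_apply, tensorHomAdj_apply]
  -- `α⁻¹` is additive since `α` is additive and bijective
  have hs : (unitInternalHomEquivW (tensor A C) B).symm (addW x y) =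
      addW ((unitInternalHomEquivW (tensor A C) B).symm x) ((unitInternalHomEquivW (tensor A C) B).symm y) := by
    apply (unitInternalHomEquivW (tensor A C) B).injective
    rw [unitInternalHomEquivW_addW, Equiv.apply_symm_apply, Equiv.apply_symm_apply, Equiv.apply_symm_apply]
  rw [hs, pushoutMapW_addW, unitInternalHomEquivW_addW]

/-- The adjunction maps the split class to the split class. [cite: Jannsen1990MixedMotives, §9 Remark 9.3 a)] -/
theorem tensorHomAdj_zeroW : tensorHomAdj A C B zeroW = zeroW := by
  rw [tensorHomAdj_apply]
  have hs : (unitInternalHomEquivW (tensor A C) B).symm zeroW = zeroW := by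
    apply (unitInternalHomEquivW (tensor A C) B).injective
    rw [Equiv.apply_symm_apply, unitInternalHomEquivW_zeroW]
  rw [hs, pushoutMapW_zeroW, unitInternalHomEquivW_zeroW]

/-- The adjunction preserves opposites. [cite: Jannsen1990MixedMotives, §9 Remark 9.3 a)] -/
theorem tensorHomAdj_negW (x : Ext (tensor A C) B) :
    tensorHomAdj A C B (negW x) = negW (tensorHomAdj A C B x) :=
  map_negW_of_addW _ (tensorHomAdj_addW A C B) (tensorHomAdj_zeroW A C B) x

/-- The inverse adjunction is additive. [cite: Jannsen1990MixedMotives, §9 Remark 9.3 a)] -/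
theorem tensorHomAdj_symm_addW (x y : Ext A (hom C B)) :
    (tensorHomAdj A C B).symm (addW x y) = addW ((tensorHomAdj A C B).symm x) ((tensorHomAdj A C B).symm y) := by
  apply (tensorHomAdj A C B).injective
  rw [tensorHomAdj_addW, Equiv.apply_symm_apply, Equiv.apply_symm_apply, Equiv.apply_symm_apply]

/-- `x = 0 ↔ adj x = 0`: an extension of `A ⊗ C` by `B` splits iff the corresponding extension of `A`
by `Hom(C, B)` splits. [cite: Jannsen1990MixedMotives, §9 Remark 9.3 a)] -/
theorem tensorHomAdj_eq_zeroW_iff (x : Ext (tensor A C) B) : tensorHomAdj A C B x = zeroW ↔ x = zeroW := by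
  rw [← tensorHomAdj_zeroW A C B, (tensorHomAdj A C B).injective.eq_iff]

omit [FiniteDimensional ℚ VE] [FiniteDimensional ℚ VE'] in
/-- On extensions: if `[F] = adj [E]` then `E` splits iff `F` splits. [cite: Jannsen1990MixedMotives, §9 Remark 9.3 a)] -/
theorem isSplit_iff_of_tensorHomAdj (E : Extension (tensor A C) B VE) (F : Extension A (hom C B) VE')
    (h : tensorHomAdj A C B (mkOfW E) = mkOfW F) : E.IsSplit ↔ F.IsSplit := by
  rw [← mkOfW_eq_zeroW_iff, ← mkOfW_eq_zeroW_iff, ← h, tensorHomAdj_eq_zeroW_iff]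

/-! ### §2 The adjunction on Beilinson's `J⁰_W(Hom)`: induced by the curry isomorphism -/

/-- `α⁻¹` followed by Lemma 9.2 is the second form of Prop. 5.22:
`unitEquivJacobianW (Hom(A, B)) (α⁻¹ x) = extEquivJacobianWHom x`.
[cite: Jannsen1990MixedMotives, §9 Remark 9.3 a)] [cite: BrylinskiZucker1998, Prop. 5.22] -/
theorem unitEquivJacobianW_unitInternalHomEquivW_symm {VX : Type*} [AddCommGroup VX] [Module ℚ VX]
    [FiniteDimensional ℚ VX] (X : MixedHodgeStructure VX) (Y : MixedHodgeStructure VB) (x : Ext X Y) :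
    unitEquivJacobianW (hom X Y) ((unitInternalHomEquivW X Y).symm x) = extEquivJacobianWHom x := by
  rw [← extEquivJacobianWHom_unitInternalHomEquivW, Equiv.apply_symm_apply]

/-- **On `J⁰_W(Hom)` the adjunction is `J⁰_W(curry)`**: under `Ext(X, Y) ≅ J⁰_W(Hom(X, Y))` (Prop. 5.22,
second form) the bijection `Ext(A ⊗ C, B) ≃ Ext(A, Hom(C, B))` is the map induced by the curry
isomorphism of internal Homs `Hom(A ⊗ C, B) ≅ Hom(A, Hom(C, B))` (naturality of Lemma 9.2,
`unitEquivJacobianW_pushoutMapW`). [cite: DeligneMilne1982Tannakian, §1 (1.6.3)]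
[cite: BrylinskiZucker1998, Prop. 5.22] -/
theorem extEquivJacobianWHom_tensorHomAdj (x : Ext (tensor A C) B) :
    extEquivJacobianWHom (tensorHomAdj A C B x) =
      (homTensorCurry A C B).jacobianWMap (extEquivJacobianWHom x) := by
  rw [tensorHomAdj_apply, extEquivJacobianWHom_unitInternalHomEquivW, unitEquivJacobianW_pushoutMapW,
    unitEquivJacobianW_unitInternalHomEquivW_symm]

/-- The inverse on `J⁰_W(Hom)` is `J⁰_W(uncurry)`. [cite: DeligneMilne1982Tannakian, §1 (1.6.3)] -/
theorem extEquivJacobianWHom_tensorHomAdj_symm (y : Ext A (hom C B)) :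
    extEquivJacobianWHom ((tensorHomAdj A C B).symm y) =
      (homTensorUncurry A C B).jacobianWMap (extEquivJacobianWHom y) := by
  rw [tensorHomAdj_symm_apply, extEquivJacobianWHom_unitInternalHomEquivW, unitEquivJacobianW_pushoutMapW,
    unitEquivJacobianW_unitInternalHomEquivW_symm]

/-- **Uniqueness**: the adjunction is the only map `Ext(A ⊗ C, B) → Ext(A, Hom(C, B))` inducing
`J⁰_W(curry)` on Beilinson's groups. [cite: BrylinskiZucker1998, Prop. 5.22] -/
theorem eq_tensorHomAdj_of_extEquivJacobianWHom (f : Ext (tensor A C) B → Ext A (hom C B))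
    (hf : ∀ x, extEquivJacobianWHom (f x) = (homTensorCurry A C B).jacobianWMap (extEquivJacobianWHom x)) :
    f = tensorHomAdj A C B := by
  funext x
  apply extEquivJacobianWHom.injective
  rw [hf, extEquivJacobianWHom_tensorHomAdj]

omit [FiniteDimensional ℚ VE] [FiniteDimensional ℚ VE'] in
/-- **On classes of extensions**: `adj [E] = [F]` iff the classes in `J⁰_W(Hom(A, Hom(C, B)))` match,
`clsJacobianW F = J⁰_W(curry) (clsJacobianW E)`. [cite: BrylinskiZucker1998, Prop. 5.22] -/
theorem tensorHomAdj_mkOfW_eq_mkOfW_iff (E : Extension (tensor A C) B VE) (F : Extension A (hom C B) VE') :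
    tensorHomAdj A C B (mkOfW E) = mkOfW F ↔
      F.clsJacobianW = (homTensorCurry A C B).jacobianWMap E.clsJacobianW := by
  rw [← extEquivJacobianWHom.injective.eq_iff, extEquivJacobianWHom_tensorHomAdj, extEquivJacobianWHom_mkOfW,
    extEquivJacobianWHom_mkOfW, eq_comm]

/-! ### §3 The rigid form: `Ext(A ⊗ C, B) ≃ Ext(A, C^∨ ⊗ B)` -/

/-- **`Ext(A ⊗ C, B) ≃ Ext(A, C^∨ ⊗ B)`**: the adjunction followed by the push-out along the
isomorphism of MHS `Hom(C, B) ≅ C^∨ ⊗ B` (Deligne–Milne (1.6.4): `Hom(X, Y) ≅ X^∨ ⊗ Y` in a rigid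
tensor category). [cite: DeligneMilne1982Tannakian, §1 (1.6.4)] -/
def tensorDualAdj : Ext (tensor A C) B ≃ Ext A (tensor C.dual B) :=
  (tensorHomAdj A C B).trans (pushoutEquivW (A := A) (homToTensor C B) (homToTensor_bijective C B))

/-- Unfolding: `tensorDualAdj x = (Hom(C, B) ≅ C^∨ ⊗ B)_* (adj x)`. [cite: DeligneMilne1982Tannakian, §1 (1.6.4)] -/
theorem tensorDualAdj_apply (x : Ext (tensor A C) B) :
    tensorDualAdj A C B x = pushoutMapW (homToTensor C B) (tensorHomAdj A C B x) := by
  rw [tensorDualAdj, Equiv.trans_apply, pushoutEquivW_apply]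

/-- The inverse: `tensorDualAdj⁻¹ y = adj⁻¹ ((C^∨ ⊗ B ≅ Hom(C, B))_* y)`. [cite: DeligneMilne1982Tannakian, §1 (1.6.4)] -/
theorem tensorDualAdj_symm_apply (y : Ext A (tensor C.dual B)) :
    (tensorDualAdj A C B).symm y =
      (tensorHomAdj A C B).symm (pushoutMapW ((homToTensor C B).inverse (homToTensor_bijective C B)) y) := by
  rw [tensorDualAdj, Equiv.symm_trans_apply, pushoutEquivW_symm_apply]

/-- `tensorDualAdj` is additive. [cite: MacLane1963Homology, Ch. III Thm. 2.1] -/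
theorem tensorDualAdj_addW (x y : Ext (tensor A C) B) :
    tensorDualAdj A C B (addW x y) = addW (tensorDualAdj A C B x) (tensorDualAdj A C B y) := by
  rw [tensorDualAdj_apply, tensorDualAdj_apply, tensorDualAdj_apply, tensorHomAdj_addW, pushoutMapW_addW]

/-- `tensorDualAdj 0 = 0`. [cite: MacLane1963Homology, Ch. III Thm. 2.1] -/
theorem tensorDualAdj_zeroW : tensorDualAdj A C B zeroW = zeroW := by
  rw [tensorDualAdj_apply, tensorHomAdj_zeroW, pushoutMapW_zeroW]

/-- `tensorDualAdj (-x) = -(tensorDualAdj x)`. [cite: MacLane1963Homology, Ch. III Thm. 2.1] -/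
theorem tensorDualAdj_negW (x : Ext (tensor A C) B) :
    tensorDualAdj A C B (negW x) = negW (tensorDualAdj A C B x) :=
  map_negW_of_addW _ (tensorDualAdj_addW A C B) (tensorDualAdj_zeroW A C B) x

/-- `x = 0 ↔ tensorDualAdj x = 0`. [cite: MacLane1963Homology, Ch. III Thm. 2.1] -/
theorem tensorDualAdj_eq_zeroW_iff (x : Ext (tensor A C) B) : tensorDualAdj A C B x = zeroW ↔ x = zeroW := by
  rw [← tensorDualAdj_zeroW A C B, (tensorDualAdj A C B).injective.eq_iff]

/-- On `J⁰_W`: `extEquivJacobianWHom (tensorDualAdj x)` is obtained from `extEquivJacobianWHom x` by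
`J⁰_W(curry)` and then `J⁰_W(Hom(A, Hom(C,B) ≅ C^∨ ⊗ B))` — the push-out step is natural for Prop. 5.22's
second form whenever it is for the first; here we record the `J⁰_W(Hom)`-class of the middle step.
[cite: BrylinskiZucker1998, Prop. 5.22] -/
theorem extEquivJacobianWHom_tensorHomAdj_of_tensorDualAdj (x : Ext (tensor A C) B) :
    extEquivJacobianWHom ((pushoutEquivW (A := A) (homToTensor C B) (homToTensor_bijective C B)).symm
      (tensorDualAdj A C B x)) = (homTensorCurry A C B).jacobianWMap (extEquivJacobianWHom x) := by
  rw [tensorDualAdj, Equiv.trans_apply, Equiv.symm_apply_apply, extEquivJacobianWHom_tensorHomAdj]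

end Ext

end MixedHodgeStructure

end Literature.AlgebraicGeometry.Motives

end
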